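import Literature.Analysis.FluidPDE.PeriodicLerayExistence
import Literature.Analysis.FluidPDE.WholeSpaceIBP
import Literature.Analysis.FluidPDE.MollifiedField
import Literature.Analysis.FluidPDE.SpaceTimeCalculusC1
import HarnessLib

/-!
# The Galerkin system of [BT1] Lemma 2.6 for the mollified perturbed Leray equations

Analysis/FluidPDE definition file, first layer under the named fact
`Literature.Analysis.FluidPDE.bradshawTsai2017_thm_2_4_mollified` (`PeriodicLerayExistence`;
Bradshaw–Tsai, Ann. Henri Poincaré 18 (2017) = arXiv:1510.07504 [BT1], Lemma 2.6 and the first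
part of the proof of Thm 2.4), whose docstring lists as "next layer down: the Galerkin system of
ODEs and Lemma 2.6 proper". [BT1] §2 (after Lemma 2.5): "We use the Galerkin method … Let
`{a_k} ⊂ 𝒱` be an orthonormal basis of `H`. For a fixed `k`, we look for an approximation
solution of the form `U_k(y,s) = Σᵢ b_{ki}(s) aᵢ(y)`. We first prove the existence of and a priori
bounds for `T`-periodic solutions `b_k = (b_{k1}, …, b_{kk})` to the system of ODEs
`d/ds b_{kj} = Σᵢ A_{ij} b_{ki} + Σ_{i,l} B_{ilj} b_{ki} b_{kl} + C_j` (`j = 1, …, k`), where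
`A_{ij} = −(∇aᵢ, ∇aⱼ) + (aᵢ + y·∇aᵢ, aⱼ) − (aᵢ·∇W, aⱼ) − (W·∇aᵢ, aⱼ)`,
`B_{ilj} = −(η_ε * aᵢ·∇a_l, aⱼ)`, `C_j = −⟨ℛ(W), aⱼ⟩`" (`ℛ(W) = LW + W·∇W`).

This file renders that system over a finite family `a : Fin k → (ℝ³ → ℝ³)` of test fields, for a
profile `W` (time `s` first, as in `PeriodicLerayExistence`) and a mollifying kernel `ρ`
(= `η_ε = BradshawTsai2019.scaledMollifier η ε`, so that `ρ ⋆ U(s) = mollify η ε U s`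
definitionally), and proves the structural facts the period-map argument of Lemma 2.6 consumes
(`Literature.Analysis.ODE.exists_periodic_solution_of_dissipative`, `ODE/PeriodicDissipative`):

* `galerkinSum a b = Σᵢ bᵢ aᵢ` (the ansatz `U_k`), a divergence-free test field when the `aᵢ`
  are, with `D(Σ bᵢaᵢ) = Σ bᵢ Daᵢ` and, for an `L²`-orthonormal family, `∫ |Σ bᵢaᵢ|² = ‖b‖²`;
* the three printed coefficient families as pairings of fields —
  `galerkinLinear W s V Z = −(∇V,∇Z) + (V + y·∇V − W·∇V − V·∇W, Z)` (`A_{ij}` at `V = aᵢ`,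
  `Z = aⱼ`), `galerkinTrilinear ρ V₁ V₂ Z = −((ρ ⋆ V₁)·∇V₂, Z)` (`B_{ilj}`),
  `galerkinSource W s Z = −⟨LW(s), Z⟩ − (W·∇W, Z) = −⟨ℛ(W), Z⟩` (`C_j`, with the accepted
  `lerayPairing`) — and `galerkinForm W ρ s U Z`, their sum at `V = V₁ = V₂ = U`: the right-hand
  side of the printed weak formulation `d/ds (U, f) = −(∇U,∇f) + (U + y·∇U, f) − ((η_ε*U)·∇U, f)
  − (W·∇U + U·∇W, f) − ⟨ℛ(W), f⟩` at `f = Z`;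
* `galerkinRHS W ρ a s b`, the vector field of the system of ODEs on `EuclideanSpace ℝ (Fin k)`
  (`F_j(s,b) = Σᵢ A_{ij}(s) bᵢ + Σ_{i,l} B_{ilj} bᵢ b_l + C_j(s)`; the printed `A`, `C` depend on
  `s` through `W(s)`), with: the **field form** `F_j(s,b) = galerkinForm W ρ s (Σ bᵢaᵢ) aⱼ` and
  `⟪F(s,b), b⟫ = galerkinForm W ρ s U U`, `U = Σ bᵢaᵢ` (multilinearity); continuity and
  `T`-periodicity in `s` (parametric integrals of jointly continuous, compactly supported
  integrands; `W ∈ C¹`, `T`-periodic); and a Lipschitz bound on every ball, uniform in `s`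
  (polynomial field with bounded coefficients).

The energy inequality `⟪F(s,b), b⟫ ≤ C₂ − ¼‖b‖² − ¾‖∇U‖²` (proof of Lemma 2.6) and Lemma 2.6
itself are the sibling proof files `PeriodicLerayGalerkinEnergy`, `PeriodicLerayGalerkin`.

## Design notes

* The mollified drift enters through a general kernel `ρ : ℝ³ → ℝ` (continuous, compactly
  supported in the lemmas that expand `ρ ⋆ Σ bᵢaᵢ = Σ bᵢ ρ ⋆ aᵢ`); [BT1] take `ρ = η_ε`.
* Orthonormality of the family is only used in `integral_inner_galerkinSum` /
  `integral_norm_sq_galerkinSum` (`(U_k, U_k) = |b_k|²`, the identification behind "multiplying the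
  `j`-th equation by `b_{kj}` and summing"); the system itself is defined for any finite family.

## Mathlib / tree search

Reused: `frobeniusInner`, `lerayPairing`, `IsRevisedProfile`, `mollify`,
`BradshawTsai2019.scaledMollifier` (`PeriodicLeraySystem`, `PeriodicLerayExistence`,
`ForwardDSSMollifiedDrift`); `frobeniusNormSq`, `convect`, `VectorCalculus.divergence/IsDivFree`
(`VectorCalculus`); `FunctionSpaces.IsTestFunctionOn`; `divergence_convolution_eq_zero`
(`MollifiedField`); slice calculus of `C¹` space–time fields (`SpaceTimeCalculusC1`); Mathlib's
`continuous_parametric_integral_of_continuous`, `HasFDerivAt.sum`, `integral_finset_sum`.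
`lean search 'galerkin'`: the tree's Galerkin systems are Fourier–Galerkin on the torus
(`NSGalerkinFourier`, `NSHopfGalerkinExistence`, `GalerkinFlow`, `TransportGalerkin*`); no
whole-space Galerkin system over a family of test fields, none for the Leray system.

## References

* Z. Bradshaw, T.-P. Tsai, *Forward discretely self-similar solutions of the Navier–Stokes
  equations II*, Ann. Henri Poincaré 18 (2017) 1095–1119 = arXiv:1510.07504, §2: the mollified
  perturbed Leray system, its weak formulation, the Galerkin system of ODEs, Lemma 2.6
  [BradshawTsai2017AHP].
* R. Temam, *Navier–Stokes Equations*, North-Holland 1977, Ch. III §3.2 (Galerkin method).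
-/

noncomputable section

open MeasureTheory Set Function Filter Topology TopologicalSpace Metric Module
open scoped NNReal ENNReal InnerProductSpace RealInnerProductSpace Convolution ContDiff

namespace Literature.Analysis.FluidPDE

/-- Local notation for physical space `ℝ³ = EuclideanSpace ℝ (Fin 3)`. -/
local notation "ℝ³" => EuclideanSpace ℝ (Fin 3)

/-! ## The Frobenius pairing is bilinear and continuous -/

section Frobenius

variable {E : Type*} [NormedAddCommGroup E] [InnerProductSpace ℝ E] [FiniteDimensional ℝ E]
variable {F : Type*} [NormedAddCommGroup F] [InnerProductSpace ℝ F]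

/-- `(A + A') : B = A : B + A' : B`. [folklore] -/
theorem frobeniusInner_add_left (A A' B : E →L[ℝ] F) :
    frobeniusInner (A + A') B = frobeniusInner A B + frobeniusInner A' B := by
  simp only [frobeniusInner, add_apply, inner_add_left,
    Finset.sum_add_distrib]

/-- `(c A) : B = c (A : B)`. [folklore] -/
theorem frobeniusInner_smul_left (c : ℝ) (A B : E →L[ℝ] F) :
    frobeniusInner (c • A) B = c * frobeniusInner A B := by
  simp only [frobeniusInner, FunLike.coe_smul, Pi.smul_apply, real_inner_smul_left,
    Finset.mul_sum]

/-- `(Σᵢ Aᵢ) : B = Σᵢ (Aᵢ : B)`. [folklore] -/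
theorem frobeniusInner_sum_left {ι : Type*} (s : Finset ι) (A : ι → E →L[ℝ] F)
    (B : E →L[ℝ] F) :
    frobeniusInner (∑ i ∈ s, A i) B = ∑ i ∈ s, frobeniusInner (A i) B := by
  simp only [frobeniusInner, FunLike.coe_sum, Finset.sum_apply, sum_inner]
  rw [Finset.sum_comm]

/-- `A : (Σⱼ Bⱼ) = Σⱼ (A : Bⱼ)`. [folklore] -/
theorem frobeniusInner_sum_right {ι : Type*} (s : Finset ι) (A : E →L[ℝ] F)
    (B : ι → E →L[ℝ] F) :
    frobeniusInner A (∑ i ∈ s, B i) = ∑ i ∈ s, frobeniusInner A (B i) := by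
  rw [frobeniusInner_comm, frobeniusInner_sum_left]
  exact Finset.sum_congr rfl fun i _ => frobeniusInner_comm _ _

/-- `A : (c B) = c (A : B)`. [folklore] -/
theorem frobeniusInner_smul_right (c : ℝ) (A B : E →L[ℝ] F) :
    frobeniusInner A (c • B) = c * frobeniusInner A B := by
  rw [frobeniusInner_comm, frobeniusInner_smul_left, frobeniusInner_comm]

/-- The Frobenius pairing is jointly continuous. [folklore] -/
theorem continuous_frobeniusInner :
    Continuous fun p : (E →L[ℝ] F) × (E →L[ℝ] F) => frobeniusInner p.1 p.2 := by
  unfold frobeniusInner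
  refine continuous_finsetSum _ fun i _ => ?_
  exact ((ContinuousLinearMap.apply ℝ F (stdOrthonormalBasis ℝ E i)).continuous.comp
    continuous_fst).inner
    ((ContinuousLinearMap.apply ℝ F (stdOrthonormalBasis ℝ E i)).continuous.comp continuous_snd)

/-- Continuity of `x ↦ A(x) : B(x)` along continuous `A`, `B`. [folklore] -/
theorem continuous_frobeniusInner_comp {X : Type*} [TopologicalSpace X] {A B : X → E →L[ℝ] F}
    (hA : Continuous A) (hB : Continuous B) :
    Continuous fun x => frobeniusInner (A x) (B x) :=
  continuous_frobeniusInner.comp (hA.prodMk hB)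

/-- Continuity of `x ↦ |A(x)|²` along a continuous `A`. [folklore] -/
theorem continuous_frobeniusNormSq_comp {X : Type*} [TopologicalSpace X] [FiniteDimensional ℝ F]
    {A : X → E →L[ℝ] F} (hA : Continuous A) :
    Continuous fun x => frobeniusNormSq (A x) := by
  have h := continuous_frobeniusInner_comp hA hA
  simp_rw [frobeniusInner_self] at h
  exact h

end Frobenius

namespace BradshawTsai2017

variable {k : ℕ}

/-! ## The Galerkin ansatz `U_k = Σᵢ b_{ki} aᵢ` -/

/-- **The Galerkin ansatz** of [BT1] Lemma 2.6: `U_k(y) = Σᵢ bᵢ aᵢ(y)` for a finite family of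
fields `a : Fin k → (ℝ³ → ℝ³)` and a coefficient vector `b ∈ ℝ^k` ("we look for an approximation
solution of the form `U_k(y,s) = Σᵢ₌₁ᵏ b_{ki}(s) aᵢ(y)`"). [cite: BradshawTsai2017AHP, §2 (Galerkin method, before Lemma 2.6)] -/
def galerkinSum (a : Fin k → ℝ³ → ℝ³) (b : EuclideanSpace ℝ (Fin k)) (y : ℝ³) : ℝ³ :=
  ∑ i, b i • a i y

/-- Unfolding `galerkinSum`. [cite: BradshawTsai2017AHP, §2 (Galerkin method)] -/
theorem galerkinSum_apply (a : Fin k → ℝ³ → ℝ³) (b : EuclideanSpace ℝ (Fin k)) (y : ℝ³) :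
    galerkinSum a b y = ∑ i, b i • a i y := rfl

/-- `Σᵢ 0·aᵢ = 0`. [folklore] -/
@[simp]
theorem galerkinSum_zero (a : Fin k → ℝ³ → ℝ³) : galerkinSum a 0 = 0 := by
  funext y; simp [galerkinSum]

/-- The ansatz is smooth when the `aᵢ` are. [folklore] -/
theorem contDiff_galerkinSum {n : WithTop ℕ∞} {a : Fin k → ℝ³ → ℝ³} (ha : ∀ i, ContDiff ℝ n (a i))
    (b : EuclideanSpace ℝ (Fin k)) : ContDiff ℝ n (galerkinSum a b) := by
  unfold galerkinSum
  exact ContDiff.sum fun i _ => (ha i).const_smul (b i)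

/-- The ansatz is compactly supported when the `aᵢ` are. [folklore] -/
theorem hasCompactSupport_galerkinSum {a : Fin k → ℝ³ → ℝ³} (ha : ∀ i, HasCompactSupport (a i))
    (b : EuclideanSpace ℝ (Fin k)) : HasCompactSupport (galerkinSum a b) := by
  refine HasCompactSupport.intro (isCompact_iUnion fun i => ha i) fun y hy => ?_
  simp only [mem_iUnion, not_exists] at hy
  refine Finset.sum_eq_zero fun i _ => ?_
  rw [image_eq_zero_of_notMem_tsupport (hy i), smul_zero]

/-- The ansatz vanishes wherever all the `aᵢ` vanish. [folklore] -/
theorem galerkinSum_eq_zero_of_forall {a : Fin k → ℝ³ → ℝ³} {y : ℝ³} (hy : ∀ i, a i y = 0)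
    (b : EuclideanSpace ℝ (Fin k)) : galerkinSum a b y = 0 :=
  Finset.sum_eq_zero fun i _ => by rw [hy i, smul_zero]

/-- The ansatz over test fields is a test field. [folklore] -/
theorem isTestFunctionOn_galerkinSum {a : Fin k → ℝ³ → ℝ³}
    (ha : ∀ i, FunctionSpaces.IsTestFunctionOn (⊤ : Opens ℝ³) (a i)) (b : EuclideanSpace ℝ (Fin k)) :
    FunctionSpaces.IsTestFunctionOn (⊤ : Opens ℝ³) (galerkinSum a b) :=
  ⟨contDiff_galerkinSum (fun i => (ha i).contDiff) b,
    hasCompactSupport_galerkinSum (fun i => (ha i).hasCompactSupport) b, by simp⟩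

/-- **`D(Σᵢ bᵢaᵢ)(y) = Σᵢ bᵢ Daᵢ(y)`** for differentiable `aᵢ`. [folklore] -/
theorem hasFDerivAt_galerkinSum {a : Fin k → ℝ³ → ℝ³} (ha : ∀ i, Differentiable ℝ (a i))
    (b : EuclideanSpace ℝ (Fin k)) (y : ℝ³) :
    HasFDerivAt (galerkinSum a b) (∑ i, b i • fderiv ℝ (a i) y) y := by
  have h : HasFDerivAt (fun y => ∑ i, b i • a i y) (∑ i, b i • fderiv ℝ (a i) y) y :=
    HasFDerivAt.fun_sum fun i _ => ((ha i) y).hasFDerivAt.const_smul (b i)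
  exact h

/-- `D(Σᵢ bᵢaᵢ)(y) = Σᵢ bᵢ Daᵢ(y)`. [folklore] -/
theorem fderiv_galerkinSum {a : Fin k → ℝ³ → ℝ³} (ha : ∀ i, Differentiable ℝ (a i))
    (b : EuclideanSpace ℝ (Fin k)) (y : ℝ³) :
    fderiv ℝ (galerkinSum a b) y = ∑ i, b i • fderiv ℝ (a i) y :=
  (hasFDerivAt_galerkinSum ha b y).fderiv

/-- `D(Σᵢ bᵢaᵢ)(y) v = Σᵢ bᵢ Daᵢ(y) v`. [folklore] -/
theorem fderiv_galerkinSum_apply {a : Fin k → ℝ³ → ℝ³} (ha : ∀ i, Differentiable ℝ (a i))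
    (b : EuclideanSpace ℝ (Fin k)) (y v : ℝ³) :
    fderiv ℝ (galerkinSum a b) y v = ∑ i, b i • fderiv ℝ (a i) y v := by
  rw [fderiv_galerkinSum ha]
  simp only [FunLike.coe_sum, FunLike.coe_smul, Finset.sum_apply, Pi.smul_apply]

/-- **`div (Σᵢ bᵢaᵢ) = Σᵢ bᵢ div aᵢ`** for differentiable `aᵢ`. [folklore] -/
theorem divergence_galerkinSum {a : Fin k → ℝ³ → ℝ³} (ha : ∀ i, Differentiable ℝ (a i))
    (b : EuclideanSpace ℝ (Fin k)) (y : ℝ³) :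
    VectorCalculus.divergence (galerkinSum a b) y = ∑ i, b i * VectorCalculus.divergence (a i) y := by
  simp only [VectorCalculus.divergence, fderiv_galerkinSum ha, ContinuousLinearMap.toLinearMap_sum,
    ContinuousLinearMap.toLinearMap_smul, map_sum, map_smul, smul_eq_mul]

/-- The ansatz over divergence-free differentiable fields is divergence free. [folklore] -/
theorem isDivFree_galerkinSum {a : Fin k → ℝ³ → ℝ³} (ha : ∀ i, Differentiable ℝ (a i))
    (hdiv : ∀ i, VectorCalculus.IsDivFree (a i)) (b : EuclideanSpace ℝ (Fin k)) :
    VectorCalculus.IsDivFree (galerkinSum a b) := fun y => by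
  rw [divergence_galerkinSum ha]
  exact Finset.sum_eq_zero fun i _ => by rw [hdiv i y, mul_zero]

/-- **`(Σᵢ bᵢaᵢ, Σⱼ b'ⱼaⱼ) = Σᵢ bᵢb'ᵢ = ⟪b, b'⟫`** for an `L²`-orthonormal family of continuous
compactly supported fields ("`{a_k}` … an orthonormal basis of `H`"). [cite: BradshawTsai2017AHP, §2 (Galerkin method)] -/
theorem integral_inner_galerkinSum {a : Fin k → ℝ³ → ℝ³} (hac : ∀ i, Continuous (a i))
    (has : ∀ i, HasCompactSupport (a i))
    (hon : ∀ i j, ∫ y, ⟪a i y, a j y⟫ = if i = j then (1 : ℝ) else 0)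
    (b b' : EuclideanSpace ℝ (Fin k)) :
    ∫ y, ⟪galerkinSum a b y, galerkinSum a b' y⟫ = ⟪b, b'⟫ := by
  have hint : ∀ i j, Integrable (fun y => ⟪a i y, a j y⟫) (volume : Measure ℝ³) := fun i j =>
    ((hac i).inner (hac j)).integrable_of_hasCompactSupport
      ((has j).mono fun y hy => by contrapose! hy; simp_all)
  have hexp : ∀ y, ⟪galerkinSum a b y, galerkinSum a b' y⟫ =
      ∑ i, ∑ j, b i * b' j * ⟪a i y, a j y⟫ := fun y => by
    simp_rw [galerkinSum, sum_inner, real_inner_smul_left, inner_sum, real_inner_smul_right,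
      Finset.mul_sum]
    refine Finset.sum_congr rfl fun i _ => Finset.sum_congr rfl fun j _ => by ring
  simp_rw [hexp]
  rw [integral_finsetSum _ fun i _ => integrable_finsetSum _ fun j _ =>
    (hint i j).const_mul _]
  simp_rw [integral_finsetSum _ fun j _ => (hint _ j).const_mul _, integral_const_mul, hon]
  simp only [mul_ite, mul_one, mul_zero, Finset.sum_ite_eq, Finset.mem_univ, if_true]
  simp [PiLp.inner_apply, mul_comm]

/-- **`∫ |Σᵢ bᵢaᵢ|² = ‖b‖²`** for an `L²`-orthonormal family. [cite: BradshawTsai2017AHP, §2 (Galerkin method)] -/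
theorem integral_norm_sq_galerkinSum {a : Fin k → ℝ³ → ℝ³} (hac : ∀ i, Continuous (a i))
    (has : ∀ i, HasCompactSupport (a i))
    (hon : ∀ i j, ∫ y, ⟪a i y, a j y⟫ = if i = j then (1 : ℝ) else 0)
    (b : EuclideanSpace ℝ (Fin k)) :
    ∫ y, ‖galerkinSum a b y‖ ^ 2 = ‖b‖ ^ 2 := by
  rw [← real_inner_self_eq_norm_sq, ← integral_inner_galerkinSum hac has hon b b]
  exact integral_congr_ae (Eventually.of_forall fun y => (real_inner_self_eq_norm_sq _).symm)

/-! ## The coefficient pairings `A_{ij}`, `B_{ilj}`, `C_j` as pairings of fields -/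

/-- The integrand of `galerkinLinear`: `−∇V:∇Z + ⟪V + (y·∇)V − (W·∇)V − (V·∇)W, Z⟫` at `y`. [cite: BradshawTsai2017AHP, §2 (A_{ij}, before Lemma 2.6)] -/
def linearIntegrand (W : ℝ → ℝ³ → ℝ³) (s : ℝ) (V Z : ℝ³ → ℝ³) (y : ℝ³) : ℝ :=
  -frobeniusInner (fderiv ℝ V y) (fderiv ℝ Z y) +
    ⟪V y + fderiv ℝ V y y - fderiv ℝ V y (W s y) - fderiv ℝ (W s) y (V y), Z y⟫

/-- **The bilinear coefficient pairing** of the Galerkin system ([BT1] §2):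
`galerkinLinear W s V Z = −(∇V, ∇Z) + (V + y·∇V, Z) − (W·∇V, Z) − (V·∇W, Z)` at time `s`, so that
`A_{ij}(s) = galerkinLinear W s aᵢ aⱼ` ("`A_{ij} = −(∇aᵢ,∇aⱼ) + (aᵢ + y·∇aᵢ, aⱼ) − (aᵢ·∇W, aⱼ)
− (W·∇aᵢ, aⱼ)`"). [cite: BradshawTsai2017AHP, §2 (A_{ij}, before Lemma 2.6)] -/
def galerkinLinear (W : ℝ → ℝ³ → ℝ³) (s : ℝ) (V Z : ℝ³ → ℝ³) : ℝ :=
  ∫ y, linearIntegrand W s V Z y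

/-- **The trilinear (mollified convection) pairing** ([BT1] §2):
`galerkinTrilinear ρ V₁ V₂ Z = −((ρ ⋆ V₁)·∇V₂, Z)`, so that `B_{ilj} = galerkinTrilinear η_ε aᵢ a_l aⱼ`
("`B_{ilj} = −(η_ε * aᵢ·∇a_l, aⱼ)`"). [cite: BradshawTsai2017AHP, §2 (B_{ilj}, before Lemma 2.6)] -/
def galerkinTrilinear (ρ : ℝ³ → ℝ) (V₁ V₂ Z : ℝ³ → ℝ³) : ℝ :=
  -∫ y, ⟪fderiv ℝ V₂ y ((ρ ⋆[ContinuousLinearMap.lsmul ℝ ℝ, volume] V₁) y), Z y⟫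

/-- **The source pairing** ([BT1] §2): `galerkinSource W s Z = −⟨ℛ(W)(s), Z⟩ = −⟨LW(s), Z⟩ −
(W·∇W, Z)` with the accepted `lerayPairing` (`ℛ(W) := ∂ₛW − ΔW − W − y·∇W + W·∇W = LW + W·∇W`),
so that `C_j(s) = galerkinSource W s aⱼ` ("`C_j = −⟨ℛ(W), aⱼ⟩`"). [cite: BradshawTsai2017AHP, §2 (C_j and ℛ(W), before Lemma 2.6)] -/
def galerkinSource (W : ℝ → ℝ³ → ℝ³) (s : ℝ) (Z : ℝ³ → ℝ³) : ℝ :=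
  -lerayPairing W s Z - ∫ y, ⟪fderiv ℝ (W s) y (W s y), Z y⟫

/-- **The right-hand side of the weak formulation of the mollified perturbed Leray system**
([BT1] §2, the display after the mollified equations) at a velocity `U` against `Z`:
`−(∇U,∇Z) + (U + y·∇U, Z) − ((ρ*U)·∇U, Z) − (W·∇U + U·∇W, Z) − ⟨ℛ(W), Z⟩`
= `galerkinLinear W s U Z + galerkinTrilinear ρ U U Z + galerkinSource W s Z`. [cite: BradshawTsai2017AHP, §2 (weak formulation of the mollified perturbed Leray system)] -/
def galerkinForm (W : ℝ → ℝ³ → ℝ³) (ρ : ℝ³ → ℝ) (s : ℝ) (U Z : ℝ³ → ℝ³) : ℝ :=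
  galerkinLinear W s U Z + galerkinTrilinear ρ U U Z + galerkinSource W s Z

/-- **The Galerkin system of ODEs** ([BT1] §2, the display before Lemma 2.6): the vector field
`F(s, b)_j = Σᵢ A_{ij}(s) bᵢ + Σ_{i,l} B_{ilj} bᵢ b_l + C_j(s)` on `ℝ^k = EuclideanSpace ℝ (Fin k)`,
whose `T`-periodic integral curves `b_k` are sought in Lemma 2.6 ("`d/ds b_{kj} = Σᵢ A_{ij}b_{ki}
+ Σ_{i,l} B_{ilj} b_{ki}b_{kl} + C_j`"). [cite: BradshawTsai2017AHP, §2 (the system of ODEs before Lemma 2.6)] -/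
def galerkinRHS (W : ℝ → ℝ³ → ℝ³) (ρ : ℝ³ → ℝ) (a : Fin k → ℝ³ → ℝ³) (s : ℝ)
    (b : EuclideanSpace ℝ (Fin k)) : EuclideanSpace ℝ (Fin k) :=
  WithLp.toLp 2 fun j => ∑ i, galerkinLinear W s (a i) (a j) * b i +
    ∑ i, ∑ l, galerkinTrilinear ρ (a i) (a l) (a j) * b i * b l + galerkinSource W s (a j)

/-- The components of the Galerkin vector field. [cite: BradshawTsai2017AHP, §2 (the system of ODEs before Lemma 2.6)] -/
theorem galerkinRHS_apply (W : ℝ → ℝ³ → ℝ³) (ρ : ℝ³ → ℝ) (a : Fin k → ℝ³ → ℝ³) (s : ℝ)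
    (b : EuclideanSpace ℝ (Fin k)) (j : Fin k) :
    galerkinRHS W ρ a s b j = ∑ i, galerkinLinear W s (a i) (a j) * b i +
      ∑ i, ∑ l, galerkinTrilinear ρ (a i) (a l) (a j) * b i * b l + galerkinSource W s (a j) := by
  simp [galerkinRHS]

/-- Unfolding `galerkinForm`. [cite: BradshawTsai2017AHP, §2 (weak formulation)] -/
theorem galerkinForm_apply (W : ℝ → ℝ³ → ℝ³) (ρ : ℝ³ → ℝ) (s : ℝ) (U Z : ℝ³ → ℝ³) :
    galerkinForm W ρ s U Z =
      galerkinLinear W s U Z + galerkinTrilinear ρ U U Z + galerkinSource W s Z := rfl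

/-! ## Multilinearity: the field form of the Galerkin system -/

section Multilinear

variable {W : ℝ → ℝ³ → ℝ³} {s : ℝ} {a : Fin k → ℝ³ → ℝ³}

/-- The linear integrand is linear in `V`: at `V = Σᵢ bᵢaᵢ` it is `Σᵢ bᵢ · (integrand at aᵢ)`. [folklore] -/
theorem linearIntegrand_galerkinSum_left (ha : ∀ i, Differentiable ℝ (a i))
    (b : EuclideanSpace ℝ (Fin k)) (Z : ℝ³ → ℝ³) (y : ℝ³) :
    linearIntegrand W s (galerkinSum a b) Z y = ∑ i, b i * linearIntegrand W s (a i) Z y := by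
  simp only [linearIntegrand, fderiv_galerkinSum ha, galerkinSum_apply, frobeniusInner_sum_left,
    frobeniusInner_smul_left, FunLike.coe_sum, FunLike.coe_smul,
    Finset.sum_apply, Pi.smul_apply, map_sum, map_smul, sum_inner, inner_add_left,
    inner_sub_left, real_inner_smul_left, ← Finset.sum_neg_distrib,
    ← Finset.sum_add_distrib, ← Finset.sum_sub_distrib]
  refine Finset.sum_congr rfl fun i _ => by ring

/-- The linear integrand is linear in `Z`: at `Z = Σⱼ bⱼaⱼ` it is `Σⱼ bⱼ · (integrand at aⱼ)`. [folklore] -/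
theorem linearIntegrand_galerkinSum_right (ha : ∀ i, Differentiable ℝ (a i)) (V : ℝ³ → ℝ³)
    (b : EuclideanSpace ℝ (Fin k)) (y : ℝ³) :
    linearIntegrand W s V (galerkinSum a b) y = ∑ j, b j * linearIntegrand W s V (a j) y := by
  simp only [linearIntegrand, fderiv_galerkinSum ha, galerkinSum_apply, frobeniusInner_sum_right,
    frobeniusInner_smul_right, inner_sum, real_inner_smul_right,
    ← Finset.sum_neg_distrib, ← Finset.sum_add_distrib]
  refine Finset.sum_congr rfl fun i _ => by ring

/-- Continuity of the linear integrand in `y` for `C¹` fields `V`, `Z` and a slice `W s` with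
continuous derivative. [folklore] -/
theorem continuous_linearIntegrand {V Z : ℝ³ → ℝ³} (hV : ContDiff ℝ 1 V) (hZ : ContDiff ℝ 1 Z)
    (hW : Continuous (W s)) (hDW : Continuous fun y => fderiv ℝ (W s) y) :
    Continuous (linearIntegrand W s V Z) := by
  unfold linearIntegrand
  have hDV := hV.continuous_fderiv one_ne_zero
  have hDZ := hZ.continuous_fderiv one_ne_zero
  refine (continuous_frobeniusInner_comp hDV hDZ).neg.add ?_
  refine Continuous.inner ?_ hZ.continuous
  exact ((hV.continuous.add (hDV.clm_apply continuous_id)).sub (hDV.clm_apply hW)).sub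
    (hDW.clm_apply hV.continuous)

/-- The linear integrand vanishes off the support of `Z`. [folklore] -/
theorem linearIntegrand_eq_zero_of_notMem {V Z : ℝ³ → ℝ³} {y : ℝ³} (hy : y ∉ tsupport Z) :
    linearIntegrand W s V Z y = 0 := by
  simp only [linearIntegrand, image_eq_zero_of_notMem_tsupport hy, fderiv_of_notMem_tsupport ℝ hy,
    frobeniusInner_zero_right, neg_zero, inner_zero_right, add_zero]

/-- The linear integrand is integrable for `C¹` `V`, a `C¹` compactly supported `Z`, and a
continuous slice `W s` with continuous derivative. [folklore] -/
theorem integrable_linearIntegrand {V Z : ℝ³ → ℝ³} (hV : ContDiff ℝ 1 V) (hZ : ContDiff ℝ 1 Z)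
    (hZc : HasCompactSupport Z) (hW : Continuous (W s))
    (hDW : Continuous fun y => fderiv ℝ (W s) y) :
    Integrable (linearIntegrand W s V Z) (volume : Measure ℝ³) :=
  (continuous_linearIntegrand hV hZ hW hDW).integrable_of_hasCompactSupport
    (hZc.mono' fun y hy => by
      by_contra h
      exact hy (linearIntegrand_eq_zero_of_notMem h))

/-- **Linearity of `galerkinLinear` in `V`** over a family of test fields against a test field:
`galerkinLinear W s (Σᵢ bᵢaᵢ) Z = Σᵢ bᵢ galerkinLinear W s aᵢ Z`. [folklore] -/
theorem galerkinLinear_galerkinSum_left (ha : ∀ i, FunctionSpaces.IsTestFunctionOn (⊤ : Opens ℝ³) (a i))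
    {Z : ℝ³ → ℝ³} (hZ : FunctionSpaces.IsTestFunctionOn (⊤ : Opens ℝ³) Z) (hW : Continuous (W s))
    (hDW : Continuous fun y => fderiv ℝ (W s) y) (b : EuclideanSpace ℝ (Fin k)) :
    galerkinLinear W s (galerkinSum a b) Z = ∑ i, b i * galerkinLinear W s (a i) Z := by
  have ha1 : ∀ i, ContDiff ℝ 1 (a i) := fun i => (ha i).contDiff.of_le (by exact_mod_cast le_top)
  have hZ1 : ContDiff ℝ 1 Z := hZ.contDiff.of_le (by exact_mod_cast le_top)
  unfold galerkinLinear
  simp_rw [linearIntegrand_galerkinSum_left (fun i => (ha1 i).differentiable one_ne_zero) b Z]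
  rw [integral_finsetSum _ fun i _ =>
    (integrable_linearIntegrand (ha1 i) hZ1 hZ.hasCompactSupport hW hDW).const_mul _]
  simp_rw [integral_const_mul]

/-- **Linearity of `galerkinLinear` in `Z`** over a family of test fields:
`galerkinLinear W s V (Σⱼ bⱼaⱼ) = Σⱼ bⱼ galerkinLinear W s V aⱼ` for `C¹` `V`. [folklore] -/
theorem galerkinLinear_galerkinSum_right (ha : ∀ i, FunctionSpaces.IsTestFunctionOn (⊤ : Opens ℝ³) (a i))
    {V : ℝ³ → ℝ³} (hV : ContDiff ℝ 1 V) (hW : Continuous (W s))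
    (hDW : Continuous fun y => fderiv ℝ (W s) y) (b : EuclideanSpace ℝ (Fin k)) :
    galerkinLinear W s V (galerkinSum a b) = ∑ j, b j * galerkinLinear W s V (a j) := by
  have ha1 : ∀ i, ContDiff ℝ 1 (a i) := fun i => (ha i).contDiff.of_le (by exact_mod_cast le_top)
  unfold galerkinLinear
  simp_rw [linearIntegrand_galerkinSum_right (fun i => (ha1 i).differentiable one_ne_zero) V b]
  rw [integral_finsetSum _ fun j _ =>
    (integrable_linearIntegrand hV (ha1 j) (ha j).hasCompactSupport hW hDW).const_mul _]
  simp_rw [integral_const_mul]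

/-! ### The trilinear pairing -/

variable {ρ : ℝ³ → ℝ}

/-- **The mollification of the ansatz is the ansatz of the mollifications**:
`ρ ⋆ (Σᵢ bᵢaᵢ) = Σᵢ bᵢ (ρ ⋆ aᵢ)` for a continuous compactly supported kernel and continuous
`aᵢ`. [folklore] -/
theorem convolution_galerkinSum (hρ : Continuous ρ) (hρc : HasCompactSupport ρ)
    (hac : ∀ i, Continuous (a i)) (b : EuclideanSpace ℝ (Fin k)) (y : ℝ³) :
    (ρ ⋆[ContinuousLinearMap.lsmul ℝ ℝ, volume] galerkinSum a b) y =
      ∑ i, b i • (ρ ⋆[ContinuousLinearMap.lsmul ℝ ℝ, volume] a i) y := by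
  simp only [convolution_lsmul, galerkinSum_apply, Finset.smul_sum]
  have hint : ∀ i, Integrable (fun t => ρ t • a i (y - t)) (volume : Measure ℝ³) := fun i =>
    (hρ.smul ((hac i).comp (continuous_const.sub continuous_id))).integrable_of_hasCompactSupport
      (hρc.smul_right)
  rw [integral_finsetSum _ fun i _ => ((hint i).smul (b i)).congr (Eventually.of_forall fun t => ?_)]
  · refine Finset.sum_congr rfl fun i _ => ?_
    rw [← integral_smul]
    exact integral_congr_ae (Eventually.of_forall fun t => smul_comm _ _ _)
  · simp only [Pi.smul_apply]
    exact smul_comm _ _ _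

/-- The mollification of a continuous compactly supported field by a continuous compactly
supported kernel is `C¹` when the kernel is, … here only: it is continuous. [folklore] -/
theorem continuous_convolution_of_continuous (hρ : Continuous ρ) (hρc : HasCompactSupport ρ)
    {V : ℝ³ → ℝ³} (hV : Continuous V) :
    Continuous (ρ ⋆[ContinuousLinearMap.lsmul ℝ ℝ, volume] V) :=
  hρc.continuous_convolution_left _ hρ (hV.locallyIntegrable)

/-- The trilinear integrand vanishes off the support of `Z`. [folklore] -/
theorem trilinearIntegrand_eq_zero_of_notMem {V₁ V₂ Z : ℝ³ → ℝ³} {y : ℝ³} (hy : y ∉ tsupport Z) :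
    ⟪fderiv ℝ V₂ y ((ρ ⋆[ContinuousLinearMap.lsmul ℝ ℝ, volume] V₁) y), Z y⟫ = 0 := by
  rw [image_eq_zero_of_notMem_tsupport hy, inner_zero_right]

/-- The trilinear integrand is integrable for continuous `V₁`, `C¹` `V₂` and a continuous
compactly supported `Z`. [folklore] -/
theorem integrable_trilinearIntegrand (hρ : Continuous ρ) (hρc : HasCompactSupport ρ)
    {V₁ V₂ Z : ℝ³ → ℝ³} (hV₁ : Continuous V₁) (hV₂ : ContDiff ℝ 1 V₂) (hZ : Continuous Z)
    (hZc : HasCompactSupport Z) :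
    Integrable (fun y => ⟪fderiv ℝ V₂ y ((ρ ⋆[ContinuousLinearMap.lsmul ℝ ℝ, volume] V₁) y), Z y⟫)
      (volume : Measure ℝ³) :=
  (((hV₂.continuous_fderiv one_ne_zero).clm_apply
    (continuous_convolution_of_continuous hρ hρc hV₁)).inner hZ).integrable_of_hasCompactSupport
    (hZc.mono' fun y hy => by
      by_contra h
      exact hy (trilinearIntegrand_eq_zero_of_notMem h))

/-- **Linearity of `galerkinTrilinear` in `V₁`**: `Γ(Σᵢ bᵢaᵢ; V₂, Z) = Σᵢ bᵢ Γ(aᵢ; V₂, Z)`. [folklore] -/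
theorem galerkinTrilinear_galerkinSum_left (hρ : Continuous ρ) (hρc : HasCompactSupport ρ)
    (ha : ∀ i, FunctionSpaces.IsTestFunctionOn (⊤ : Opens ℝ³) (a i)) {V₂ Z : ℝ³ → ℝ³}
    (hV₂ : ContDiff ℝ 1 V₂) (hZ : Continuous Z) (hZc : HasCompactSupport Z)
    (b : EuclideanSpace ℝ (Fin k)) :
    galerkinTrilinear ρ (galerkinSum a b) V₂ Z = ∑ i, b i * galerkinTrilinear ρ (a i) V₂ Z := by
  unfold galerkinTrilinear
  simp_rw [convolution_galerkinSum hρ hρc (fun i => (ha i).contDiff.continuous) b, map_sum,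
    map_smul, sum_inner, real_inner_smul_left]
  rw [integral_finsetSum _ fun i _ => (integrable_trilinearIntegrand hρ hρc
    (ha i).contDiff.continuous hV₂ hZ hZc).const_mul _]
  simp_rw [integral_const_mul, ← Finset.sum_neg_distrib, mul_neg]

/-- **Linearity of `galerkinTrilinear` in `V₂`**: `Γ(V₁; Σₗ bₗaₗ, Z) = Σₗ bₗ Γ(V₁; aₗ, Z)`. [folklore] -/
theorem galerkinTrilinear_galerkinSum_mid (hρ : Continuous ρ) (hρc : HasCompactSupport ρ)
    (ha : ∀ i, FunctionSpaces.IsTestFunctionOn (⊤ : Opens ℝ³) (a i)) {V₁ Z : ℝ³ → ℝ³}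
    (hV₁ : Continuous V₁) (hZ : Continuous Z) (hZc : HasCompactSupport Z)
    (b : EuclideanSpace ℝ (Fin k)) :
    galerkinTrilinear ρ V₁ (galerkinSum a b) Z = ∑ l, b l * galerkinTrilinear ρ V₁ (a l) Z := by
  have ha1 : ∀ i, ContDiff ℝ 1 (a i) := fun i => (ha i).contDiff.of_le (by exact_mod_cast le_top)
  unfold galerkinTrilinear
  simp_rw [fderiv_galerkinSum_apply (fun i => (ha1 i).differentiable one_ne_zero), sum_inner,
    real_inner_smul_left]
  rw [integral_finsetSum _ fun l _ => (integrable_trilinearIntegrand hρ hρc hV₁ (ha1 l) hZ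
    hZc).const_mul _]
  simp_rw [integral_const_mul, ← Finset.sum_neg_distrib, mul_neg]

/-- **Linearity of `galerkinTrilinear` in `Z`**: `Γ(V₁; V₂, Σⱼ bⱼaⱼ) = Σⱼ bⱼ Γ(V₁; V₂, aⱼ)`. [folklore] -/
theorem galerkinTrilinear_galerkinSum_right (hρ : Continuous ρ) (hρc : HasCompactSupport ρ)
    (ha : ∀ i, FunctionSpaces.IsTestFunctionOn (⊤ : Opens ℝ³) (a i)) {V₁ V₂ : ℝ³ → ℝ³}
    (hV₁ : Continuous V₁) (hV₂ : ContDiff ℝ 1 V₂) (b : EuclideanSpace ℝ (Fin k)) :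
    galerkinTrilinear ρ V₁ V₂ (galerkinSum a b) = ∑ j, b j * galerkinTrilinear ρ V₁ V₂ (a j) := by
  unfold galerkinTrilinear
  simp_rw [galerkinSum_apply, inner_sum, real_inner_smul_right]
  rw [integral_finsetSum _ fun j _ => (integrable_trilinearIntegrand hρ hρc hV₁ hV₂
    (ha j).contDiff.continuous (ha j).hasCompactSupport).const_mul _]
  simp_rw [integral_const_mul, ← Finset.sum_neg_distrib, mul_neg]

/-! ### The source pairing -/

/-- The integrand of the accepted `lerayPairing W s ζ`, named. [cite: BradshawTsai2017AHP, §2 (the pairing ⟨LW,ζ⟩ after Assumption 2.1)] -/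
def lerayIntegrand (W : ℝ → ℝ³ → ℝ³) (s : ℝ) (ζ : ℝ³ → ℝ³) (y : ℝ³) : ℝ :=
  ⟪timeDeriv W s y - W s y - fderiv ℝ (W s) y y, ζ y⟫ +
    frobeniusInner (fderiv ℝ (W s) y) (fderiv ℝ ζ y)

/-- `lerayPairing W s ζ = ∫ lerayIntegrand W s ζ`. [cite: BradshawTsai2017AHP, §2 (the pairing ⟨LW,ζ⟩)] -/
theorem lerayPairing_eq_integral (W : ℝ → ℝ³ → ℝ³) (s : ℝ) (ζ : ℝ³ → ℝ³) :
    lerayPairing W s ζ = ∫ y, lerayIntegrand W s ζ y := rfl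

/-- The Leray integrand vanishes off the support of `ζ`. [folklore] -/
theorem lerayIntegrand_eq_zero_of_notMem {ζ : ℝ³ → ℝ³} {y : ℝ³} (hy : y ∉ tsupport ζ) :
    lerayIntegrand W s ζ y = 0 := by
  simp only [lerayIntegrand, image_eq_zero_of_notMem_tsupport hy, fderiv_of_notMem_tsupport ℝ hy,
    inner_zero_right, frobeniusInner_zero_right, add_zero]

/-- Continuity of the Leray integrand in `y` for a `C¹` `ζ` and a slice with continuous
`W s`, `∂ₛW(s)`, `D(W s)`. [folklore] -/
theorem continuous_lerayIntegrand {ζ : ℝ³ → ℝ³} (hζ : ContDiff ℝ 1 ζ) (hW : Continuous (W s))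
    (hWt : Continuous (timeDeriv W s)) (hDW : Continuous fun y => fderiv ℝ (W s) y) :
    Continuous (lerayIntegrand W s ζ) := by
  unfold lerayIntegrand
  exact (((hWt.sub hW).sub (hDW.clm_apply continuous_id)).inner hζ.continuous).add
    (continuous_frobeniusInner_comp hDW (hζ.continuous_fderiv one_ne_zero))

/-- The Leray integrand is integrable for a `C¹` compactly supported `ζ`. [folklore] -/
theorem integrable_lerayIntegrand {ζ : ℝ³ → ℝ³} (hζ : ContDiff ℝ 1 ζ) (hζc : HasCompactSupport ζ)
    (hW : Continuous (W s)) (hWt : Continuous (timeDeriv W s))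
    (hDW : Continuous fun y => fderiv ℝ (W s) y) :
    Integrable (lerayIntegrand W s ζ) (volume : Measure ℝ³) :=
  (continuous_lerayIntegrand hζ hW hWt hDW).integrable_of_hasCompactSupport
    (hζc.mono' fun y hy => by
      by_contra h
      exact hy (lerayIntegrand_eq_zero_of_notMem h))

/-- The Leray integrand is linear in `ζ` over the ansatz. [folklore] -/
theorem lerayIntegrand_galerkinSum (ha : ∀ i, Differentiable ℝ (a i)) (b : EuclideanSpace ℝ (Fin k))
    (y : ℝ³) : lerayIntegrand W s (galerkinSum a b) y = ∑ j, b j * lerayIntegrand W s (a j) y := by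
  simp only [lerayIntegrand, fderiv_galerkinSum ha, galerkinSum_apply, frobeniusInner_sum_right,
    frobeniusInner_smul_right, inner_sum, real_inner_smul_right, ← Finset.sum_add_distrib]
  refine Finset.sum_congr rfl fun i _ => by ring

/-- **Linearity of the accepted `lerayPairing` in the test slot** over a family of test fields:
`⟨LW(s), Σⱼ bⱼaⱼ⟩ = Σⱼ bⱼ ⟨LW(s), aⱼ⟩`. [folklore] -/
theorem lerayPairing_galerkinSum (ha : ∀ i, FunctionSpaces.IsTestFunctionOn (⊤ : Opens ℝ³) (a i))
    (hW : Continuous (W s)) (hWt : Continuous (timeDeriv W s))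
    (hDW : Continuous fun y => fderiv ℝ (W s) y) (b : EuclideanSpace ℝ (Fin k)) :
    lerayPairing W s (galerkinSum a b) = ∑ j, b j * lerayPairing W s (a j) := by
  have ha1 : ∀ i, ContDiff ℝ 1 (a i) := fun i => (ha i).contDiff.of_le (by exact_mod_cast le_top)
  simp_rw [lerayPairing_eq_integral]
  simp_rw [lerayIntegrand_galerkinSum (fun i => (ha1 i).differentiable one_ne_zero) b]
  rw [integral_finsetSum _ fun j _ =>
    (integrable_lerayIntegrand (ha1 j) (ha j).hasCompactSupport hW hWt hDW).const_mul _]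
  simp_rw [integral_const_mul]

/-- The self-convection integrand `⟪(W·∇)W, Z⟫` is integrable for continuous compactly
supported `Z`. [folklore] -/
theorem integrable_inner_convect_profile {Z : ℝ³ → ℝ³} (hZ : Continuous Z)
    (hZc : HasCompactSupport Z) (hW : Continuous (W s))
    (hDW : Continuous fun y => fderiv ℝ (W s) y) :
    Integrable (fun y => ⟪fderiv ℝ (W s) y (W s y), Z y⟫) (volume : Measure ℝ³) :=
  ((hDW.clm_apply hW).inner hZ).integrable_of_hasCompactSupport
    (hZc.mono' fun y hy => by
      by_contra h
      exact hy (by simp only [image_eq_zero_of_notMem_tsupport h, inner_zero_right]))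

/-- **Linearity of `galerkinSource` in `Z`**: `c(s; Σⱼ bⱼaⱼ) = Σⱼ bⱼ c(s; aⱼ)`. [folklore] -/
theorem galerkinSource_galerkinSum (ha : ∀ i, FunctionSpaces.IsTestFunctionOn (⊤ : Opens ℝ³) (a i))
    (hW : Continuous (W s)) (hWt : Continuous (timeDeriv W s))
    (hDW : Continuous fun y => fderiv ℝ (W s) y) (b : EuclideanSpace ℝ (Fin k)) :
    galerkinSource W s (galerkinSum a b) = ∑ j, b j * galerkinSource W s (a j) := by
  unfold galerkinSource
  rw [lerayPairing_galerkinSum ha hW hWt hDW]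
  simp_rw [galerkinSum_apply, inner_sum, real_inner_smul_right]
  rw [integral_finsetSum _ fun j _ => (integrable_inner_convect_profile (ha j).contDiff.continuous
    (ha j).hasCompactSupport hW hDW).const_mul _]
  simp_rw [integral_const_mul]
  simp only [mul_sub, mul_neg, Finset.sum_sub_distrib, Finset.sum_neg_distrib]

/-! ### The field form of the Galerkin system -/

/-- **Slice regularity hypotheses** on the profile at time `s` used by the expansions: `W s`,
`∂ₛW(s)` and `D(W s)` continuous (all consequences of `ContDiff ℝ 1 (uncurry W)`,
`SliceRegular.of_contDiff`). [folklore] -/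
structure SliceRegular (W : ℝ → ℝ³ → ℝ³) (s : ℝ) : Prop where
  /-- `W s` is continuous. -/
  continuous : Continuous (W s)
  /-- `∂ₛW(s, ·)` is continuous. -/
  continuous_timeDeriv : Continuous (timeDeriv W s)
  /-- `D(W s)` is continuous. -/
  continuous_fderiv : Continuous fun y => fderiv ℝ (W s) y
  /-- `W s` is `C¹`. -/
  contDiff : ContDiff ℝ 1 (W s)

/-- A jointly `C¹` profile has regular slices. [folklore] -/
theorem SliceRegular.of_contDiff (hW : ContDiff ℝ 1 (uncurry W)) (s : ℝ) : SliceRegular W s where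
  continuous := hW.continuous.comp (continuous_const.prodMk continuous_id)
  continuous_timeDeriv := by
    have h := continuousOn_timeDerivWithin_of_contDiffOn (S := (univ : Set ℝ)) (w := W)
      (by rw [univ_prod_univ]; exact hW.contDiffOn) uniqueDiffOn_univ
    rw [univ_prod_univ, continuousOn_univ] at h
    have e : (fun y => timeDeriv W s y) = fun y => timeDerivWithin univ W s y := by
      funext y; simp [timeDeriv, timeDerivWithin]
    show Continuous fun y => timeDeriv W s y
    rw [e]
    exact h.comp (continuous_const.prodMk continuous_id)
  continuous_fderiv := by
    have h := continuousOn_fderiv_slice_of_contDiffOn (S := (univ : Set ℝ)) (w := W)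
      (by rw [univ_prod_univ]; exact hW.contDiffOn) uniqueDiffOn_univ
    rw [univ_prod_univ, continuousOn_univ] at h
    exact h.comp (continuous_const.prodMk continuous_id)
  contDiff := contDiff_slice_of_contDiffOn (S := (univ : Set ℝ))
    (by rw [univ_prod_univ]; exact hW.contDiffOn) (mem_univ s)

/-- **The field form of the Galerkin system**: for test fields `aᵢ`, a regular slice `W s` and a
continuous compactly supported kernel, the `j`-th component of the Galerkin vector field at `b` is
the right-hand side of the weak formulation at `U = Σᵢ bᵢaᵢ` tested against `aⱼ`:
`F_j(s, b) = galerkinForm W ρ s U aⱼ` (multilinearity of the three pairings). [cite: BradshawTsai2017AHP, §2 (the system of ODEs as the weak formulation on span{a₁,…,a_k})] -/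
theorem galerkinRHS_apply_eq_galerkinForm (hρ : Continuous ρ) (hρc : HasCompactSupport ρ)
    (ha : ∀ i, FunctionSpaces.IsTestFunctionOn (⊤ : Opens ℝ³) (a i)) (hW : SliceRegular W s)
    (b : EuclideanSpace ℝ (Fin k)) (j : Fin k) :
    galerkinRHS W ρ a s b j = galerkinForm W ρ s (galerkinSum a b) (a j) := by
  have hUc : Continuous (galerkinSum a b) := (contDiff_galerkinSum (fun i => (ha i).contDiff) b).continuous
  rw [galerkinRHS_apply, galerkinForm_apply,
    galerkinLinear_galerkinSum_left ha (ha j) hW.continuous hW.continuous_fderiv b,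
    galerkinTrilinear_galerkinSum_left hρ hρc ha
      ((contDiff_galerkinSum (fun i => (ha i).contDiff) b).of_le (by exact_mod_cast le_top))
      (ha j).contDiff.continuous (ha j).hasCompactSupport b]
  simp_rw [galerkinTrilinear_galerkinSum_mid hρ hρc ha (ha _).contDiff.continuous
    (ha j).contDiff.continuous (ha j).hasCompactSupport b, Finset.mul_sum]
  congr 1
  congr 1
  · exact Finset.sum_congr rfl fun i _ => mul_comm _ _
  · exact Finset.sum_congr rfl fun i _ => Finset.sum_congr rfl fun l _ => by ring

/-- **`⟪F(s, b), b⟫ = galerkinForm W ρ s U U`, `U = Σᵢ bᵢaᵢ`** — "multiplying the `j`-th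
equation of the system by `b_{kj}` and summing" turns the Galerkin system into the weak
formulation tested against `U_k` itself. [cite: BradshawTsai2017AHP, proof of Lemma 2.6 (multiplying the j-th equation by b_{kj} and summing)] -/
theorem inner_galerkinRHS_eq_galerkinForm (hρ : Continuous ρ) (hρc : HasCompactSupport ρ)
    (ha : ∀ i, FunctionSpaces.IsTestFunctionOn (⊤ : Opens ℝ³) (a i)) (hW : SliceRegular W s)
    (b : EuclideanSpace ℝ (Fin k)) :
    ⟪galerkinRHS W ρ a s b, b⟫ = galerkinForm W ρ s (galerkinSum a b) (galerkinSum a b) := by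
  have hU : FunctionSpaces.IsTestFunctionOn (⊤ : Opens ℝ³) (galerkinSum a b) :=
    isTestFunctionOn_galerkinSum ha b
  have hU1 : ContDiff ℝ 1 (galerkinSum a b) := hU.contDiff.of_le (by exact_mod_cast le_top)
  have h1 : ⟪galerkinRHS W ρ a s b, b⟫ = ∑ j, b j * galerkinRHS W ρ a s b j := by
    simp [PiLp.inner_apply]
  rw [h1, galerkinForm_apply, galerkinLinear_galerkinSum_right ha hU1 hW.continuous
    hW.continuous_fderiv b, galerkinTrilinear_galerkinSum_right hρ hρc ha hU.contDiff.continuous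
    hU1 b, galerkinSource_galerkinSum ha hW.continuous hW.continuous_timeDeriv
    hW.continuous_fderiv b, ← Finset.sum_add_distrib, ← Finset.sum_add_distrib]
  refine Finset.sum_congr rfl fun j _ => ?_
  rw [galerkinRHS_apply_eq_galerkinForm hρ hρc ha hW b j, galerkinForm_apply]
  ring

end Multilinear

/-! ## Regularity in `s`: continuity and periodicity of the coefficients -/

section Regularity

variable {W : ℝ → ℝ³ → ℝ³} {a : Fin k → ℝ³ → ℝ³} {ρ : ℝ³ → ℝ} {T : ℝ}

/-- Joint continuity of the slice derivative `(s, y) ↦ D(W s)(y)` of a `C¹` profile. [folklore] -/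
theorem continuous_fderiv_slice (hW : ContDiff ℝ 1 (uncurry W)) :
    Continuous fun z : ℝ × ℝ³ => fderiv ℝ (W z.1) z.2 := by
  have h := continuousOn_fderiv_slice_of_contDiffOn (S := (univ : Set ℝ)) (w := W)
    (by rw [univ_prod_univ]; exact hW.contDiffOn) uniqueDiffOn_univ
  rw [univ_prod_univ, continuousOn_univ] at h
  exact h

/-- Joint continuity of `(s, y) ↦ ∂ₛW(s, y)` of a `C¹` profile. [folklore] -/
theorem continuous_timeDeriv_uncurry (hW : ContDiff ℝ 1 (uncurry W)) :
    Continuous fun z : ℝ × ℝ³ => timeDeriv W z.1 z.2 := by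
  have h := continuousOn_timeDerivWithin_of_contDiffOn (S := (univ : Set ℝ)) (w := W)
    (by rw [univ_prod_univ]; exact hW.contDiffOn) uniqueDiffOn_univ
  rw [univ_prod_univ, continuousOn_univ] at h
  have e : (fun z : ℝ × ℝ³ => timeDeriv W z.1 z.2) = fun z => timeDerivWithin univ W z.1 z.2 := by
    funext z; simp [timeDeriv, timeDerivWithin]
  rw [e]
  exact h

/-- Joint continuity of the linear integrand `(s, y) ↦ linearIntegrand W s V Z y`. [folklore] -/
theorem continuous_uncurry_linearIntegrand (hW : ContDiff ℝ 1 (uncurry W)) {V Z : ℝ³ → ℝ³}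
    (hV : ContDiff ℝ 1 V) (hZ : ContDiff ℝ 1 Z) :
    Continuous (uncurry fun s y => linearIntegrand W s V Z y) := by
  have hsnd : Continuous fun z : ℝ × ℝ³ => z.2 := continuous_snd
  have hDV := (hV.continuous_fderiv one_ne_zero).comp hsnd
  have hDZ := (hZ.continuous_fderiv one_ne_zero).comp hsnd
  have hVc := hV.continuous.comp hsnd
  have hZc := hZ.continuous.comp hsnd
  have hWc : Continuous fun z : ℝ × ℝ³ => W z.1 z.2 := hW.continuous
  have hDW := continuous_fderiv_slice hW
  show Continuous fun z : ℝ × ℝ³ => linearIntegrand W z.1 V Z z.2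
  unfold linearIntegrand
  refine (continuous_frobeniusInner_comp hDV hDZ).neg.add ?_
  refine Continuous.inner ?_ hZc
  exact ((hVc.add (hDV.clm_apply hsnd)).sub (hDV.clm_apply hWc)).sub (hDW.clm_apply hVc)

/-- **Continuity of `s ↦ A_{ij}(s)`**: `s ↦ galerkinLinear W s V Z` is continuous for a `C¹`
profile, a `C¹` `V` and a `C¹` compactly supported `Z` (parametric integral of a jointly
continuous integrand supported in `ℝ × tsupport Z`). [folklore] -/
theorem continuous_galerkinLinear (hW : ContDiff ℝ 1 (uncurry W)) {V Z : ℝ³ → ℝ³}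
    (hV : ContDiff ℝ 1 V) (hZ : ContDiff ℝ 1 Z) (hZc : HasCompactSupport Z) :
    Continuous fun s => galerkinLinear W s V Z := by
  have h := continuous_parametric_integral_of_continuous (μ := (volume : Measure ℝ³))
    (continuous_uncurry_linearIntegrand hW hV hZ) hZc
  refine h.congr fun s => ?_
  exact setIntegral_eq_integral_of_forall_compl_eq_zero fun y hy =>
    linearIntegrand_eq_zero_of_notMem hy

/-- Joint continuity of the Leray integrand `(s, y) ↦ lerayIntegrand W s ζ y`. [folklore] -/
theorem continuous_uncurry_lerayIntegrand (hW : ContDiff ℝ 1 (uncurry W)) {ζ : ℝ³ → ℝ³}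
    (hζ : ContDiff ℝ 1 ζ) : Continuous (uncurry fun s y => lerayIntegrand W s ζ y) := by
  have hsnd : Continuous fun z : ℝ × ℝ³ => z.2 := continuous_snd
  have hDζ := (hζ.continuous_fderiv one_ne_zero).comp hsnd
  have hζc := hζ.continuous.comp hsnd
  have hWc : Continuous fun z : ℝ × ℝ³ => W z.1 z.2 := hW.continuous
  have hDW := continuous_fderiv_slice hW
  have hWt := continuous_timeDeriv_uncurry hW
  show Continuous fun z : ℝ × ℝ³ => lerayIntegrand W z.1 ζ z.2
  unfold lerayIntegrand
  exact (((hWt.sub hWc).sub (hDW.clm_apply hsnd)).inner hζc).add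
    (continuous_frobeniusInner_comp hDW hDζ)

/-- **Continuity of `s ↦ ⟨LW(s), ζ⟩`** for a `C¹` profile and a `C¹` compactly supported `ζ`. [folklore] -/
theorem continuous_lerayPairing (hW : ContDiff ℝ 1 (uncurry W)) {ζ : ℝ³ → ℝ³}
    (hζ : ContDiff ℝ 1 ζ) (hζc : HasCompactSupport ζ) :
    Continuous fun s => lerayPairing W s ζ := by
  have h := continuous_parametric_integral_of_continuous (μ := (volume : Measure ℝ³))
    (continuous_uncurry_lerayIntegrand hW hζ) hζc
  refine h.congr fun s => ?_
  rw [lerayPairing_eq_integral]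
  exact setIntegral_eq_integral_of_forall_compl_eq_zero fun y hy =>
    lerayIntegrand_eq_zero_of_notMem hy

/-- **Continuity of `s ↦ C_j(s)`**: `s ↦ galerkinSource W s Z` is continuous for a `C¹` profile
and a `C¹` compactly supported `Z`. [folklore] -/
theorem continuous_galerkinSource (hW : ContDiff ℝ 1 (uncurry W)) {Z : ℝ³ → ℝ³}
    (hZ : ContDiff ℝ 1 Z) (hZc : HasCompactSupport Z) :
    Continuous fun s => galerkinSource W s Z := by
  have hcont : Continuous (uncurry fun s y => ⟪fderiv ℝ (W s) y (W s y), Z y⟫) := by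
    show Continuous fun z : ℝ × ℝ³ => ⟪fderiv ℝ (W z.1) z.2 (W z.1 z.2), Z z.2⟫
    exact ((continuous_fderiv_slice hW).clm_apply hW.continuous).inner
      (hZ.continuous.comp continuous_snd)
  have h := continuous_parametric_integral_of_continuous (μ := (volume : Measure ℝ³)) hcont hZc
  have h' : Continuous fun s => ∫ y, ⟪fderiv ℝ (W s) y (W s y), Z y⟫ := by
    refine h.congr fun s => ?_
    exact setIntegral_eq_integral_of_forall_compl_eq_zero fun y hy => by
      simp only [image_eq_zero_of_notMem_tsupport hy, inner_zero_right]
  unfold galerkinSource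
  exact (continuous_lerayPairing hW hZ hZc).neg.sub h'

/-- A `T`-periodic profile has `T`-periodic slices as functions. [folklore] -/
theorem slice_add_period (hper : ∀ s y, W (s + T) y = W s y) (s : ℝ) : W (s + T) = W s :=
  funext (hper s)

/-- The time derivative of a `T`-periodic profile is `T`-periodic. [folklore] -/
theorem timeDeriv_add_period (hper : ∀ s y, W (s + T) y = W s y) (s : ℝ) (y : ℝ³) :
    timeDeriv W (s + T) y = timeDeriv W s y := by
  simp only [timeDeriv]
  have e : (fun τ => W τ y) = fun τ => W (τ + T) y := funext fun τ => (hper τ y).symm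
  have h2 : deriv (fun τ => W (τ + T) y) s = deriv (fun x => W x y) (s + T) :=
    deriv_comp_add_const (f := fun x => W x y) T s
  rw [← h2, ← e]

/-- **Periodicity of `A_{ij}`**: `galerkinLinear W (s + T) V Z = galerkinLinear W s V Z` for a
`T`-periodic profile. [folklore] -/
theorem galerkinLinear_add_period (hper : ∀ s y, W (s + T) y = W s y) (s : ℝ) (V Z : ℝ³ → ℝ³) :
    galerkinLinear W (s + T) V Z = galerkinLinear W s V Z := by
  simp only [galerkinLinear, linearIntegrand, slice_add_period hper]

/-- **Periodicity of `⟨LW(s), ζ⟩`** for a `T`-periodic profile. [folklore] -/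
theorem lerayPairing_add_period (hper : ∀ s y, W (s + T) y = W s y) (s : ℝ) (ζ : ℝ³ → ℝ³) :
    lerayPairing W (s + T) ζ = lerayPairing W s ζ := by
  simp only [lerayPairing, slice_add_period hper, timeDeriv_add_period hper]

/-- **Periodicity of `C_j`**: `galerkinSource W (s + T) Z = galerkinSource W s Z`. [folklore] -/
theorem galerkinSource_add_period (hper : ∀ s y, W (s + T) y = W s y) (s : ℝ) (Z : ℝ³ → ℝ³) :
    galerkinSource W (s + T) Z = galerkinSource W s Z := by
  simp only [galerkinSource, lerayPairing_add_period hper, slice_add_period hper]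

/-- **Periodicity of the Galerkin vector field** in `s` for a `T`-periodic profile. [cite: BradshawTsai2017AHP, Lemma 2.6 (T-periodicity)] -/
theorem galerkinRHS_add_period (hper : ∀ s y, W (s + T) y = W s y) (s : ℝ)
    (b : EuclideanSpace ℝ (Fin k)) : galerkinRHS W ρ a (s + T) b = galerkinRHS W ρ a s b := by
  simp only [galerkinRHS, galerkinLinear_add_period hper, galerkinSource_add_period hper]

/-- `galerkinForm` is `T`-periodic in `s` for a `T`-periodic profile. [folklore] -/
theorem galerkinForm_add_period (hper : ∀ s y, W (s + T) y = W s y) (s : ℝ) (U Z : ℝ³ → ℝ³) :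
    galerkinForm W ρ (s + T) U Z = galerkinForm W ρ s U Z := by
  simp only [galerkinForm, galerkinLinear_add_period hper, galerkinSource_add_period hper]

/-- A continuous `T`-periodic real function is bounded. [folklore] -/
theorem exists_bound_of_continuous_periodic {f : ℝ → ℝ} (hf : Continuous f) (hT : 0 < T)
    (hper : ∀ s, f (s + T) = f s) : ∃ C : ℝ, 0 ≤ C ∧ ∀ s, |f s| ≤ C := by
  obtain ⟨C, hC⟩ := (isCompact_Icc (a := (0 : ℝ)) (b := T)).exists_bound_of_continuousOn
    hf.continuousOn
  refine ⟨max C 0, le_max_right _ _, fun s => ?_⟩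
  obtain ⟨y, hy, hfy⟩ := Function.Periodic.exists_mem_Ico₀ hper hT s
  rw [hfy]
  exact (Real.norm_eq_abs _ ▸ hC y (Ico_subset_Icc_self hy)).trans (le_max_left _ _)

/-- **Continuity of the Galerkin vector field in `s`** (for fixed `b`): the coefficients
`A_{ij}(s)`, `C_j(s)` are continuous for a `C¹` profile and test fields `aᵢ`. [cite: BradshawTsai2017AHP, Lemma 2.6 (the system of ODEs)] -/
theorem continuous_galerkinRHS (hW : ContDiff ℝ 1 (uncurry W))
    (ha : ∀ i, FunctionSpaces.IsTestFunctionOn (⊤ : Opens ℝ³) (a i)) (b : EuclideanSpace ℝ (Fin k)) :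
    Continuous fun s => galerkinRHS W ρ a s b := by
  have ha1 : ∀ i, ContDiff ℝ 1 (a i) := fun i => (ha i).contDiff.of_le (by exact_mod_cast le_top)
  have hA : ∀ i j, Continuous fun s => galerkinLinear W s (a i) (a j) := fun i j =>
    continuous_galerkinLinear hW (ha1 i) (ha1 j) (ha j).hasCompactSupport
  have hC : ∀ j, Continuous fun s => galerkinSource W s (a j) := fun j =>
    continuous_galerkinSource hW (ha1 j) (ha j).hasCompactSupport
  have hcomp : Continuous fun s => (fun j => ∑ i, galerkinLinear W s (a i) (a j) * b i +
      ∑ i, ∑ l, galerkinTrilinear ρ (a i) (a l) (a j) * b i * b l + galerkinSource W s (a j)) :=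
    continuous_pi fun j => ((continuous_finsetSum _ fun i _ => (hA i j).mul continuous_const).add
      continuous_const).add (hC j)
  exact (PiLp.continuous_toLp 2 _).comp hcomp

end Regularity

/-! ## Polynomial vector fields on `ℝ^k`: a Lipschitz bound on balls -/

section Poly

/-- `|xᵢ| ≤ ‖x‖` in `EuclideanSpace ℝ (Fin k)` (twin of `Literature.Analysis.Complex.abs_apply_le_norm_euclidean`
of `Complex/BochnerTubeGrowth`, whose import closure — several complex variables — is kept out of
this file's). [folklore] -/
theorem abs_apply_le_norm (x : EuclideanSpace ℝ (Fin k)) (i : Fin k) : |x i| ≤ ‖x‖ := by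
  rw [EuclideanSpace.norm_eq]
  refine Real.abs_le_sqrt ?_
  rw [← sq_abs, ← Real.norm_eq_abs]
  exact Finset.single_le_sum (fun j _ => sq_nonneg ‖x j‖) (Finset.mem_univ i)

/-- `‖x‖ ≤ Σⱼ |xⱼ|` in `EuclideanSpace ℝ (Fin k)` (`ℓ² ≤ ℓ¹`). [folklore] -/
theorem norm_le_sum_abs (x : EuclideanSpace ℝ (Fin k)) : ‖x‖ ≤ ∑ j, |x j| := by
  rw [EuclideanSpace.norm_eq]
  have h0 : 0 ≤ ∑ j, |x j| := Finset.sum_nonneg fun j _ => abs_nonneg _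
  calc Real.sqrt (∑ j, ‖x j‖ ^ 2) ≤ Real.sqrt ((∑ j, |x j|) ^ 2) := by
        refine Real.sqrt_le_sqrt ?_
        rw [sq, Finset.sum_mul]
        refine Finset.sum_le_sum fun j _ => ?_
        rw [Real.norm_eq_abs, sq]
        exact mul_le_mul_of_nonneg_left
          (Finset.single_le_sum (fun i _ => abs_nonneg (x i)) (Finset.mem_univ j)) (abs_nonneg _)
    _ = ∑ j, |x j| := Real.sqrt_sq h0

/-- **A quadratic polynomial vector field** on `ℝ^k`:
`P(b)_j = Σᵢ M_{ij} bᵢ + Σ_{i,l} N_{ilj} bᵢ b_l + c_j` — the shape of the Galerkin system at a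
frozen time. [folklore] -/
def polyField (M : Fin k → Fin k → ℝ) (N : Fin k → Fin k → Fin k → ℝ) (c : Fin k → ℝ)
    (b : EuclideanSpace ℝ (Fin k)) : EuclideanSpace ℝ (Fin k) :=
  WithLp.toLp 2 fun j => ∑ i, M i j * b i + ∑ i, ∑ l, N i l j * b i * b l + c j

/-- The components of `polyField`. [folklore] -/
theorem polyField_apply (M : Fin k → Fin k → ℝ) (N : Fin k → Fin k → Fin k → ℝ) (c : Fin k → ℝ)
    (b : EuclideanSpace ℝ (Fin k)) (j : Fin k) :
    polyField M N c b j = ∑ i, M i j * b i + ∑ i, ∑ l, N i l j * b i * b l + c j := by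
  simp [polyField]

/-- The Galerkin vector field at time `s` is the polynomial field with the printed coefficients
`A_{ij}(s)`, `B_{ilj}`, `C_j(s)`. [cite: BradshawTsai2017AHP, §2 (the system of ODEs before Lemma 2.6)] -/
theorem galerkinRHS_eq_polyField (W : ℝ → ℝ³ → ℝ³) (ρ : ℝ³ → ℝ) (a : Fin k → ℝ³ → ℝ³) (s : ℝ) :
    galerkinRHS W ρ a s = polyField (fun i j => galerkinLinear W s (a i) (a j))
      (fun i l j => galerkinTrilinear ρ (a i) (a l) (a j)) fun j => galerkinSource W s (a j) := rfl

/-- **Lipschitz bound for quadratic polynomial fields on balls**: if `|M_{ij}| ≤ μ` and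
`|N_{ilj}| ≤ ν` (`μ, ν ≥ 0`) then `polyField M N c` is Lipschitz on the ball `‖b‖ ≤ R` with constant
`k (k μ + k² (2 R ν))` (componentwise: `|ΔP_j| ≤ Σᵢ |M_{ij}| |Δbᵢ| + Σ_{il} |N_{ilj}| |bᵢb_l − b'ᵢb'_l|`,
`|bᵢb_l − b'ᵢb'_l| ≤ 2R ‖b − b'‖`, and `‖x‖ ≤ Σⱼ|xⱼ|`). [folklore] -/
theorem lipschitzOnWith_polyField {M : Fin k → Fin k → ℝ} {N : Fin k → Fin k → Fin k → ℝ}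
    (c : Fin k → ℝ) {μ ν R : ℝ} (hμ : ∀ i j, |M i j| ≤ μ) (hν : ∀ i l j, |N i l j| ≤ ν)
    (hμ0 : 0 ≤ μ) (hν0 : 0 ≤ ν) (hR : 0 ≤ R) :
    LipschitzOnWith (Real.toNNReal ((k : ℝ) * ((k : ℝ) * μ + (k : ℝ) * (k : ℝ) * (2 * R * ν))))
      (polyField M N c) (closedBall (0 : EuclideanSpace ℝ (Fin k)) R) := by
  set K : ℝ := (k : ℝ) * ((k : ℝ) * μ + (k : ℝ) * (k : ℝ) * (2 * R * ν)) with hK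
  have hK0 : 0 ≤ K := by positivity
  refine LipschitzOnWith.of_dist_le_mul fun b hb b' hb' => ?_
  rw [mem_closedBall, dist_zero_right] at hb hb'
  have hd : ∀ i, |b i - b' i| ≤ ‖b - b'‖ := fun i => by
    have h := abs_apply_le_norm (b - b') i
    simpa using h
  have hbi : ∀ i, |b i| ≤ R := fun i => (abs_apply_le_norm b i).trans hb
  have hb'i : ∀ i, |b' i| ≤ R := fun i => (abs_apply_le_norm b' i).trans hb'
  have hprod : ∀ i l, |b i * b l - b' i * b' l| ≤ 2 * R * ‖b - b'‖ := fun i l => by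
    have e : b i * b l - b' i * b' l = b i * (b l - b' l) + (b i - b' i) * b' l := by ring
    rw [e]
    calc |b i * (b l - b' l) + (b i - b' i) * b' l|
        ≤ |b i * (b l - b' l)| + |(b i - b' i) * b' l| := abs_add_le _ _
      _ = |b i| * |b l - b' l| + |b i - b' i| * |b' l| := by rw [abs_mul, abs_mul]
      _ ≤ R * ‖b - b'‖ + ‖b - b'‖ * R :=
          add_le_add (mul_le_mul (hbi i) (hd l) (abs_nonneg _) hR)
            (mul_le_mul (hd i) (hb'i l) (abs_nonneg _) (norm_nonneg _))
      _ = 2 * R * ‖b - b'‖ := by ring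
  have hcomp : ∀ j, |polyField M N c b j - polyField M N c b' j| ≤
      ((k : ℝ) * μ + (k : ℝ) * (k : ℝ) * (2 * R * ν)) * ‖b - b'‖ := fun j => by
    rw [polyField_apply, polyField_apply]
    have e : (∑ i, M i j * b i + ∑ i, ∑ l, N i l j * b i * b l + c j) -
          (∑ i, M i j * b' i + ∑ i, ∑ l, N i l j * b' i * b' l + c j) =
        ∑ i, M i j * (b i - b' i) + ∑ i, ∑ l, N i l j * (b i * b l - b' i * b' l) := by
      simp only [mul_sub, Finset.sum_sub_distrib, mul_assoc]
      ring
    rw [e]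
    calc |∑ i, M i j * (b i - b' i) + ∑ i, ∑ l, N i l j * (b i * b l - b' i * b' l)|
        ≤ |∑ i, M i j * (b i - b' i)| + |∑ i, ∑ l, N i l j * (b i * b l - b' i * b' l)| :=
          abs_add_le _ _
      _ ≤ ∑ i, |M i j * (b i - b' i)| + ∑ i, |∑ l, N i l j * (b i * b l - b' i * b' l)| :=
          add_le_add (Finset.abs_sum_le_sum_abs _ _) (Finset.abs_sum_le_sum_abs _ _)
      _ ≤ ∑ i, |M i j * (b i - b' i)| + ∑ i, ∑ l, |N i l j * (b i * b l - b' i * b' l)| :=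
          add_le_add le_rfl (Finset.sum_le_sum fun i _ => Finset.abs_sum_le_sum_abs _ _)
      _ ≤ ∑ _i : Fin k, μ * ‖b - b'‖ + ∑ _i : Fin k, ∑ _l : Fin k, ν * (2 * R * ‖b - b'‖) := by
          refine add_le_add (Finset.sum_le_sum fun i _ => ?_)
            (Finset.sum_le_sum fun i _ => Finset.sum_le_sum fun l _ => ?_)
          · rw [abs_mul]; exact mul_le_mul (hμ i j) (hd i) (abs_nonneg _) hμ0
          · rw [abs_mul]; exact mul_le_mul (hν i l j) (hprod i l) (abs_nonneg _) hν0
      _ = ((k : ℝ) * μ + (k : ℝ) * (k : ℝ) * (2 * R * ν)) * ‖b - b'‖ := by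
          simp only [Finset.sum_const, Finset.card_univ, Fintype.card_fin, nsmul_eq_mul]
          ring
  calc dist (polyField M N c b) (polyField M N c b')
      = ‖polyField M N c b - polyField M N c b'‖ := dist_eq_norm _ _
    _ ≤ ∑ j, |(polyField M N c b - polyField M N c b') j| := norm_le_sum_abs _
    _ = ∑ j, |polyField M N c b j - polyField M N c b' j| := by
        simp only [PiLp.sub_apply]
    _ ≤ ∑ _j : Fin k, ((k : ℝ) * μ + (k : ℝ) * (k : ℝ) * (2 * R * ν)) * ‖b - b'‖ :=
        Finset.sum_le_sum fun j _ => hcomp j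
    _ = K * ‖b - b'‖ := by
        simp only [Finset.sum_const, Finset.card_univ, Fintype.card_fin, nsmul_eq_mul, hK]
        ring
    _ = (Real.toNNReal K : ℝ) * dist b b' := by rw [Real.coe_toNNReal _ hK0, dist_eq_norm]

variable {W : ℝ → ℝ³ → ℝ³} {a : Fin k → ℝ³ → ℝ³} {T : ℝ}

/-- **The Galerkin vector field is Lipschitz on every ball, uniformly in `s`** (its coefficients
`A_{ij}(s)` are continuous and `T`-periodic, hence bounded; `B_{ilj}` is constant) — the
hypothesis of the period-map argument ("there exist `b_{kj}(s)` uniquely solving (eq:ODE)",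
proof of Lemma 2.6). [cite: BradshawTsai2017AHP, proof of Lemma 2.6 (local well-posedness of the Galerkin system)] -/
theorem exists_lipschitzOnWith_galerkinRHS (hT : 0 < T) (hW : ContDiff ℝ 1 (uncurry W))
    (hper : ∀ s y, W (s + T) y = W s y)
    (ha : ∀ i, FunctionSpaces.IsTestFunctionOn (⊤ : Opens ℝ³) (a i)) (ρ : ℝ³ → ℝ) (R : ℝ) :
    ∃ K : ℝ≥0, ∀ s, LipschitzOnWith K (galerkinRHS W ρ a s)
      (closedBall (0 : EuclideanSpace ℝ (Fin k)) R) := by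
  have ha1 : ∀ i, ContDiff ℝ 1 (a i) := fun i => (ha i).contDiff.of_le (by exact_mod_cast le_top)
  have hA : ∀ i j, ∃ C : ℝ, 0 ≤ C ∧ ∀ s, |galerkinLinear W s (a i) (a j)| ≤ C := fun i j =>
    exists_bound_of_continuous_periodic
      (continuous_galerkinLinear hW (ha1 i) (ha1 j) (ha j).hasCompactSupport) hT
      fun s => galerkinLinear_add_period hper s _ _
  choose C hC0 hC using hA
  set μ : ℝ := ∑ i, ∑ j, C i j with hμ
  have hμ0 : 0 ≤ μ := Finset.sum_nonneg fun i _ => Finset.sum_nonneg fun j _ => hC0 i j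
  have hμb : ∀ s i j, |galerkinLinear W s (a i) (a j)| ≤ μ := fun s i j => by
    refine (hC i j s).trans ?_
    calc C i j ≤ ∑ j', C i j' :=
          Finset.single_le_sum (f := fun j' => C i j') (fun j' _ => hC0 i j') (Finset.mem_univ j)
      _ ≤ μ := Finset.single_le_sum (f := fun i' => ∑ j', C i' j')
          (fun i' _ => Finset.sum_nonneg fun j' _ => hC0 i' j') (Finset.mem_univ i)
  set ν : ℝ := ∑ i, ∑ l, ∑ j, |galerkinTrilinear ρ (a i) (a l) (a j)| with hν
  have hν0 : 0 ≤ ν := Finset.sum_nonneg fun i _ => Finset.sum_nonneg fun l _ =>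
    Finset.sum_nonneg fun j _ => abs_nonneg _
  have hνb : ∀ i l j, |galerkinTrilinear ρ (a i) (a l) (a j)| ≤ ν := fun i l j => by
    calc |galerkinTrilinear ρ (a i) (a l) (a j)|
        ≤ ∑ j', |galerkinTrilinear ρ (a i) (a l) (a j')| :=
          Finset.single_le_sum (f := fun j' => |galerkinTrilinear ρ (a i) (a l) (a j')|)
            (fun j' _ => abs_nonneg _) (Finset.mem_univ j)
      _ ≤ ∑ l', ∑ j', |galerkinTrilinear ρ (a i) (a l') (a j')| :=
          Finset.single_le_sum (f := fun l' => ∑ j', |galerkinTrilinear ρ (a i) (a l') (a j')|)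
            (fun l' _ => Finset.sum_nonneg fun j' _ => abs_nonneg _) (Finset.mem_univ l)
      _ ≤ ν := Finset.single_le_sum
          (f := fun i' => ∑ l', ∑ j', |galerkinTrilinear ρ (a i') (a l') (a j')|)
          (fun i' _ => Finset.sum_nonneg fun l' _ => Finset.sum_nonneg fun j' _ => abs_nonneg _)
          (Finset.mem_univ i)
  refine ⟨Real.toNNReal ((k : ℝ) * ((k : ℝ) * μ + (k : ℝ) * (k : ℝ) * (2 * max R 0 * ν))),
    fun s => ?_⟩
  rw [galerkinRHS_eq_polyField]
  exact (lipschitzOnWith_polyField _ (hμb s) hνb hμ0 hν0 (le_max_right R 0)).mono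
    (closedBall_subset_closedBall (le_max_left R 0))

end Poly

end BradshawTsai2017

end Literature.Analysis.FluidPDE
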